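import Literature.NumberTheory.LFunctions.WeilExplicit
import Literature.NumberTheory.LFunctions.WeilExplicitFormulaProofs
import Literature.NumberTheory.LFunctions.WeilExplicitArchTermProofs
import Mathlib.Data.Nat.Prime.Int
import Mathlib.Algebra.FiniteSupport.Defs
import Mathlib.MeasureTheory.Function.JacobianOneDim
import HarnessLib

/-!
# Connes' trace formula on the adèle class space and the Weil explicit formula (Connes 1999) — the
# statement layer for `k = ℚ`

Topic `Literature/NumberTheory/ConnesConsani` (the Connes–Consani programme; this file is the 1999
trace-formula layer). STATEMENT LEVEL ONLY: definitions with bodies and ONE named fact; no proof of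
a theorem of the source is claimed here.

Source: A. Connes, *Trace formula in noncommutative geometry and the zeros of the Riemann zeta
function*, Selecta Math. (N.S.) 5 (1999) 29–106 = arXiv:math/9811068 [bib `Connes1999`]; section and
equation numbers below are those of the paper (they agree in the arXiv and Selecta versions).

## What the paper proves, verbatim (and what is typed here)

Let `k` be a global field, `A` its adèles, `C_k = GL₁(A)/GL₁(k)` the idèle class group with module
`| · |`, Haar measures `d*` normalised by `∫_{|g| ∈ [1,Λ]} d*g ∼ log Λ` (III (14), V (14), VII (4)),
`X = A/k*` the adèle class space, `𝒮(A)₀ = {f ∈ 𝒮(A) : f(0) = 0, ∫ f dx = 0}` (III (6)),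
`E(f)(g) = |g|^{1/2} Σ_{q ∈ k*} f(qg)` (III (18)), `(U(λ)ξ)(x) = ξ(λ⁻¹x)`, `U(h) = ∫ h(λ) U(λ) d*λ`.

* **Theorem III.1** (spectral realisation, with the Sobolev label `δ > 1`). "Let `χ ∈ K̂`, `δ > 1`,
  `ℋ_χ` and `D_χ` be as above. Then `D_χ` has discrete spectrum, `Sp D_χ ⊂ iℝ` is the set of
  imaginary parts of zeros of the `L` function with Grössencharakter `χ̃` which have real part equal
  to `1/2`; `ρ ∈ Sp D ⇔ L(χ̃, 1/2 + ρ) = 0` and `ρ ∈ iℝ` […]. Moreover the multiplicity of `ρ` in `Sp D`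
  is equal to the largest integer `n < (1+δ)/2`, `n ≤` multiplicity of `1/2 + ρ` as a zero of `L`."
  Here `ℋ = L²_δ(C_k)/Im E` (the cokernel of `E` on the weighted space `L²_δ`, III (7), (12)) and
  `D_χ` generates the action of `ℝ₊* ≅ N ⊂ C_k` on the sector `ℋ_χ` (III (23)–(26)).
  **Corollary III.2**: for `h ∈ 𝒮(C_k)`, `W(h) = ∫ W(g) h(g) d*g` is trace class on `ℋ` and
  `Trace W(h) = Σ_{L(χ̃, 1/2+ρ) = 0, ρ ∈ iℝ/N^⊥} ĥ(χ̃, ρ)`, `ĥ(χ̃, ρ) = ∫ h(u) χ̃(u) |u|^ρ d*u`.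
  NOT TYPED (needs the completion `L²_δ(X)`, the cokernel and the generator of a non-unitary
  one-parameter group; Mathlib has no trace class). The tree's abstract rendering of "a self-adjoint
  trace formula equal to Weil's functional" is `LinearPMap.SelfAdjointTraceFormula`
  (`Literature/Analysis/UnboundedOperators/TraceFormula.lean`).
* **Theorem V.3** (local trace formula, PROVED). "Let `K` be a local field with basic character `α`.
  Let `h ∈ 𝒮(K*)` have compact support. Then `R_Λ U(h)` is a trace class operator and when `Λ → ∞`,
  one has `Trace(R_Λ U(h)) = 2h(1) log′Λ + ∫′ h(u⁻¹)/|1-u| d*u + o(1)` where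
  `2 log′Λ = ∫_{λ ∈ K*, |λ| ∈ [Λ⁻¹,Λ]} d*λ`, and the principal value `∫′` is uniquely determined by
  the pairing with the unique distribution on `K` which agrees with `du/|1-u|` for `u ≠ 1` and whose
  Fourier transform vanishes at `1`." Here `P_Λ = 1_{|x| ≤ Λ}`, `P̂_Λ = F P_Λ F⁻¹`, `R_Λ = P̂_Λ P_Λ`
  on `L²(K)` (V (15)–(16)).
* **Theorem VII.4** (S-local trace formula, PROVED). For `S ∋` all infinite places finite, `A_S =
  ∏_{v∈S} k_v`, `O_S*` the `S`-units, `C_S = J_S/O_S*`, `X_S = A_S/O_S*`, `L²(X_S)` the completion of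
  `𝒮(A_S)` for `‖f‖² = ∫ |Σ_{q ∈ O_S*} f(qx)|² |x| d*x` (VII (5)), `R_Λ = P̂_Λ P_Λ` (VII (12)–(13)):
  "Let `h ∈ 𝒮(C_S)` have compact support. Then when `Λ → ∞`, one has
  `Trace(R_Λ U(h)) = 2h(1) log′Λ + Σ_{v∈S} ∫′_{k_v*} h(u⁻¹)/|1-u| d*u + o(1)`" (each `k_v*` embedded
  in `C_S` by `u ↦ (1,…,u,…,1)`). NOT TYPED as an operator statement (trace class); its RIGHT-HAND
  SIDE for `k = ℚ`, `S = {∞} ∪ P`, is `connesSemilocalGeometricSide` below.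
* **Theorem VIII.5** (PROVED, positive characteristic). "Let `k` be a global field of positive
  characteristic and `Q_Λ` be the orthogonal projection on the subspace of `L²(X)` spanned by the
  `f ∈ 𝒮(A)` such that `f(x)` and `f̂(x)` vanish for `|x| > Λ`. Let `h ∈ 𝒮(C_k)` have compact
  support. Then the following conditions are equivalent, a) When `Λ → ∞`, one has
  `Trace(Q_Λ U(h)) = 2h(1) log′Λ + Σ_v ∫′_{k_v*} h(u⁻¹)/|1-u| d*u + o(1)`; b) All `L` functions
  with Grössencharakter on `k` satisfy the Riemann Hypothesis." The mechanism of a) ⇒ b) (VIII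
  (17)–(26)): `E` is a SURJECTIVE isometry `L²(X)₀ → L²(C_k)` for `δ = 0`, `E(B_{Λ,0}) ⊂ S_Λ`
  (functions supported in `|g| ∈ [Λ⁻¹,Λ]`), hence `Δ_Λ(f) = Trace((S_Λ - Q′_{Λ,0})V(f))` is of
  POSITIVE TYPE (`Δ_Λ(f * f*) ≥ 0`), `Trace(S_Λ V(f)) = 2f(1) log′Λ`, and a) makes `lim Δ_Λ` equal to
  Weil's distribution `Δ` (App. II (5)), whose positivity is RH by Weil's criterion [W3]; b) ⇒ a) by
  the explicit formulas and Lemma VIII.3 (non-critical zeros enter through the harmonic measure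
  `dμ_ρ`). For NUMBER FIELDS the paper gives the cutoff `B_Λ` for `k = ℚ` via the prolate spheroidal
  functions of Landau–Pollak–Slepian (VIII (31)–(33): "the linear span of the `ψ_n`, `n ≤ 4Λ²`", even
  functions, `ψ ↦ ψ ⊗ 1_R`) and states "This gives the analogue of Lemma 1, Theorem 5, and Lemma 3"
  without a separately numbered theorem; the global formula VIII (16) itself is "left open"
  (Introduction). NOT TYPED: RH for all Hecke `L`-functions of a function field and the operator
  `Q_Λ` are outside the tree's vocabulary; the `ζ`-only positivity criterion that a) ⇒ b) rests on is
  IN THE TREE and PROVED: `weil_criterion_holds : RiemannHypothesis ↔ WeilPositivity`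
  (`WeilCriterionProofs.lean`). A conjecture is never vendored as a fact (CONVENTIONS §4): VIII (16)
  for `k = ℚ` is not stated here as a `def … : Prop` of Literature.
* **Appendix II, Theorem 6** (the explicit formula rewritten with the trace-formula principal
  values, PROVED from Weil [W3] + Lemmas II.2–II.3). "Let `k` be a global field, `α` a non trivial
  character of `A/k` and `α = Π α_v` its local factors. Let `h ∈ 𝒮(C_k)` have compact support, then
  `ĥ(0) + ĥ(1) - Σ_{L(χ,ρ) = 0, 0 < Re ρ < 1} ĥ(χ, ρ) = Σ_v ∫′_{k_v*} h(u⁻¹)/|1-u| d*u` where the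
  normalization of `∫′` is given by `α_v` as in theorem V.3, and `ĥ(χ, z) = ∫ h(u) χ(u) |u|^z d*u`."
  TYPED below for `k = ℚ`, the standard character `α = e^{-2πi x_∞} ∏_p α_p` (all local factors
  normalised, so the `log|λ|` of Lemma II.3 and `log|d|` vanish) and `h` invariant under `Ẑ* ⊂ C_ℚ`
  (then only the trivial character of `C_{ℚ,1}` contributes, App. II (14)–(17)): the named fact
  `Connes1999_thm_6_rat`, with the archimedean principal value in the printed form App. II (36)
  (`λ = log 2π + γ`) and the finite places evaluated shell by shell from App. II (9) + Lemma II.2.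

## Dictionary with the tree's Weil layer (`Literature/NumberTheory/LFunctions/WeilExplicit.lean`)

`C_ℚ = Ẑ* × ℝ₊*`; a `Ẑ*`-invariant `h ∈ 𝒮(C_ℚ)` of compact support is `h(j) = H(|j|)` with
`H ∈ C_c^∞(ℝ₊*)`; put `g(t) := e^{t/2} H(e^t)`, i.e. `H(x) = x^{-1/2} g(log x)` (`connesRadial g`).
Then `g` is a Weil test function (`IsWeilTest g`), `h(1) = g(0)`, and with `d*u = (Haar prob. on Ẑ*)
× dx/x`: `ĥ(z) = ∫₀^∞ H(x) x^z dx/x = ∫ g(t) e^{(z-1/2)t} dt = weilMellin g z`; so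
`ĥ(0) + ĥ(1) = weilPolarTerm g` and the zero sum `Σ_ρ N(ρ) ĥ(ρ)` (Weil's symmetric limit, App. II
(4)) is the tree's `HasWeilZeroSide g`. At `v = p`: `u ∈ ℚ_p*` has `|u| = |u|_p`, `h(u⁻¹) =
H(|u|_p⁻¹)`; the unit shell contributes `0` (App. II (9), Lemma II.2), the shell `v_p(u) = -m`
(`m ≥ 1`) has `d*`-mass `log p` and `|1-u|_p = p^m`, the shell `v_p(u) = m` has mass `log p` and
`|1-u|_p = 1`; total `log p Σ_{m≥1} (H(p^m) + p^{-m} H(p^{-m})) = log p Σ_{m≥1} p^{-m/2}(g(m log p) +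
g(-m log p))` (`connesLocalTerm p g`; summed over `p` this is `weilPrimeTerm g` by `n = p^m` — an
identity we record but do not prove here). At `v = ∞`: `ℝ* ∋ u`, `d*u = du/(2|u|)` (V (14): both
signs), `f(u) := h(u⁻¹) = |u|^{1/2} g(-log|u|)`, and App. II (36):
`∫′_ℝ f(u)/|1-u| d*u = (log 2π + γ) f(1) + lim_{ε→0} (∫_{|1-u| ≥ ε} f(u)/|1-u| d*u + (log ε) f(1))`
(`connesArchTrunc`, `connesArchPV`). Equating with the tree's PROVED explicit formula
(`explicit_formula_holds`: `Σ_ρ ĝ(ρ) = weilPolarTerm g - weilPrimeTerm g + weilArchTerm g`) gives the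
dictionary `connesArchPV g = - weilArchTerm g = (log 4π + γ) g(0) + ∫₀^∞ (e^{t/2}(g(t)+g(-t)) -
2g(0))/(2 sinh t) dt` (Bombieri's form, `weilArchTermBombieri_eq_weilArchTerm_holds`); the two agree
by `e^{t/2}/(2 sinh t) = 1/(4 sinh(t/2)) + 1/(4 cosh(t/2))` and `∫_ε^∞ dt/sinh t = -log tanh(ε/2)`
(so `Connes1999_thm_6_rat` is dischargeable from the tree: DISCHARGED at the end of this file,
`Connes1999_thm_6_rat_holds`, appended 2026-08-19, together with the unconditional dictionary
`connesArchPV_eq_neg_weilArchTerm`).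

## Deliberately NOT here
The Hilbert spaces `L²_δ(X)`, `L²(X_S)`, the operators `E`, `D_χ`, `R_Λ`, `Q_Λ`, trace class; global
fields other than `ℚ`; non-trivial Grössencharakters; the char. `p` Theorem VIII.5 (see above).
-/

noncomputable section

open Complex Filter Set MeasureTheory
open scoped Topology

namespace Literature.NumberTheory.ConnesConsani

open Literature.NumberTheory.LFunctions

/-! ## The dictionary `h(j) = H(|j|)`, `H(x) = x^{-1/2} g(log x)` -/

/-- Connes' `Ẑ*`-invariant test function on `C_ℚ = Ẑ* × ℝ₊*` attached to a Weil test function `g`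
of the tree (additive variable `t = log x`): `H(x) = x^{-1/2} g(log x)` for `x > 0`, so that
`ĥ(z) = ∫₀^∞ H(x) x^z dx/x = weilMellin g z` and `h(1) = H(1) = g(0)` (Connes 1999, App. II (12)
with `F(|g|) = |g|^{-1/2} h(g⁻¹)`). Only used for `x > 0`. [cite: Connes1999, App. II (12)] -/
def connesRadial (g : ℝ → ℂ) (x : ℝ) : ℂ :=
  ((x ^ (-(1 / 2 : ℝ)) : ℝ) : ℂ) * g (Real.log x)

/-- Unfolding `connesRadial`. [folklore] -/
theorem connesRadial_apply (g : ℝ → ℂ) (x : ℝ) :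
    connesRadial g x = ((x ^ (-(1 / 2 : ℝ)) : ℝ) : ℂ) * g (Real.log x) :=
  rfl

/-- `h(1) = H(1) = g(0)`. [folklore] -/
@[simp] theorem connesRadial_one (g : ℝ → ℂ) : connesRadial g 1 = g 0 := by
  simp [connesRadial]

/-! ## The local terms `∫′_{ℚ_v*} h(u⁻¹)/|1-u| d*u` of the trace formula, `k = ℚ` -/

/-- The finite-place term of Connes' trace formula at `v = p`, for a `Ẑ*`-invariant test function
`h(j) = H(|j|)`, `H = connesRadial g`: the principal value `∫′_{ℚ_p*} h(u⁻¹)/|1-u|_p d*u`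
(Thm VII.4, App. II Thm 6) EVALUATED shell by shell — the unit shell `ℤ_p*` contributes `0`
(App. II (9) with Lemma II.2 for the normalised character `α_p`), the shell `v_p(u) = -m`, `m ≥ 1`,
has `d*`-mass `log p` and `|1-u|_p = p^m`, the shell `v_p(u) = m ≥ 1` has mass `log p` and
`|1-u|_p = 1` — giving `log p Σ_{m≥1} (H(p^m) + p^{-m} H(p^{-m}))
= log p Σ_{m≥1} p^{-m/2} (g(m log p) + g(-m log p))`. Written as a `tsum` over `m : ℕ` with the
shift `m ↦ m+1`; for `g` of compact support only finitely many terms are non-zero. Summed over the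
primes this is the tree's `weilPrimeTerm g` (`n = p^m`, `Λ(p^m) = log p`).
[cite: Connes1999, Thm VII.4 and App. II (8)–(9), Lemma II.2] -/
def connesLocalTerm (p : ℕ) (g : ℝ → ℂ) : ℂ :=
  ∑' m : ℕ, (Real.log p : ℂ) * (((p : ℝ) ^ (-((m + 1 : ℕ) : ℝ) / 2) : ℝ) : ℂ) *
    (g ((m + 1 : ℕ) * Real.log p) + g (-((m + 1 : ℕ) * Real.log p)))

/-- The truncated archimedean principal value of App. II (36), for the function
`f(u) = h(u⁻¹) = |u|^{1/2} g(-log|u|)` on `ℝ*` and the normalised Haar measure `d*u = du/(2|u|)` of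
`ℝ*` (V (14): `∫_{|λ| ∈ [1,Λ]} d*λ ∼ log Λ`, both signs of `λ`):
`∫_{|1-u| ≥ ε} f(u)/|1-u| d*u + (log ε) f(1)`, with `f(1) = g(0)`. (The point `u = 0` is
Lebesgue-null; there Lean's `x / 0 = 0` is harmless.) [cite: Connes1999, App. II (36)] -/
def connesArchTrunc (g : ℝ → ℂ) (ε : ℝ) : ℂ :=
  (∫ u in {u : ℝ | ε ≤ |1 - u|},
      (((|u| ^ (1 / 2 : ℝ)) / |1 - u| / (2 * |u|) : ℝ) : ℂ) * g (-Real.log |u|)) +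
    (Real.log ε : ℂ) * g 0

/-- Connes' archimedean principal value `∫′_ℝ f(u)/|1-u| d*u` for `f(u) = h(u⁻¹) = |u|^{1/2}
g(-log|u|)`, App. II (36) with the normalised character `α(x) = e^{-2πix}` (App. II (30)):
`∫′_ℝ f(u)/|1-u| d*u = λ f(1) + lim_{ε → 0} (∫_{|1-u| ≥ ε} f(u)/|1-u| d*u + (log ε) f(1))`,
`λ = log(2π) + γ`. DEFINITION with a `limUnder` along `ε → 0⁺` (junk value if the limit does not
exist; for Weil test functions it exists — part of `Connes1999_thm_6_rat`). By the dictionary of the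
module docstring it equals `- weilArchTerm g` of the tree. [cite: Connes1999, App. II (36)–(37) and Lemma II.3] -/
def connesArchPV (g : ℝ → ℂ) : ℂ :=
  (Real.log (2 * Real.pi) + Real.eulerMascheroniConstant : ℂ) * g 0 +
    limUnder (𝓝[>] (0 : ℝ)) (connesArchTrunc g)

/-- The GEOMETRIC SIDE (right-hand side) of Connes' `S`-local trace formula, Theorem VII.4, for
`k = ℚ` and `S = {∞} ∪ P` (`P` a finite set of primes), on a test function `h ∈ 𝒮(C_S)` of compact
support invariant under `∏_{p ∈ P} ℤ_p*`, `h(j) = H(|j|)`, `H = connesRadial g`: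
`2h(1) log′Λ + Σ_{v ∈ S} ∫′_{ℚ_v*} h(u⁻¹)/|1-u| d*u` with `2 log′Λ = ∫_{λ ∈ C_S, |λ| ∈ [Λ⁻¹,Λ]} d*λ
= 2 log Λ` (the module of `C_S` is onto `ℝ₊*` since `∞ ∈ S`). The theorem says this equals
`Trace(R_Λ U(h)) + o(1)` as `Λ → ∞`; the LEFT-hand side (a trace-class statement on `L²(X_S)`) is not
typed in the tree (no trace class in Mathlib). Elements of `P` that are not prime contribute
junk terms; use `P ⊆ primes`. [cite: Connes1999, Thm VII.4] -/
def connesSemilocalGeometricSide (P : Finset ℕ) (Λ : ℝ) (g : ℝ → ℂ) : ℂ :=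
  2 * (Real.log Λ : ℂ) * g 0 + ∑ p ∈ P, connesLocalTerm p g + connesArchPV g

/-- Unfolding `connesSemilocalGeometricSide` for `S = {∞}` (`P = ∅`): `2 g(0) log Λ + ∫′_ℝ`.
[folklore] -/
theorem connesSemilocalGeometricSide_empty (Λ : ℝ) (g : ℝ → ℂ) :
    connesSemilocalGeometricSide ∅ Λ g = 2 * (Real.log Λ : ℂ) * g 0 + connesArchPV g := by
  simp [connesSemilocalGeometricSide]

/-! ## Appendix II, Theorem 6 for `k = ℚ` (named fact) -/

/-- **Connes 1999, Appendix II, Theorem 6, for `k = ℚ`, the standard character and `Ẑ*`-invariant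
test functions** (the Weil explicit formula in the form predicted by the trace formula; proved in
the source from A. Weil's explicit formula [W3] and Lemmas II.2–II.3 comparing Weil's principal
values `Pfw` with the `∫′` of Theorem V.3). Printed statement: "Let `k` be a global field, `α` a non
trivial character of `A/k` and `α = Π α_v` its local factors. Let `h ∈ 𝒮(C_k)` have compact support,
then `ĥ(0) + ĥ(1) - Σ_{L(χ,ρ)=0, 0<Re ρ<1} ĥ(χ,ρ) = Σ_v ∫′_{k_v*} h(u⁻¹)/|1-u| d*u`". Specialised
(module docstring dictionary): for every Weil test function `g` (`h(j) = |j|^{-1/2} g(log|j|)` on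
`C_ℚ`), the `ε → 0⁺` limit defining the archimedean principal value App. II (36) exists, and the
symmetric zero sum `Σ_ρ N(ρ) ĝ(ρ)` (`HasWeilZeroSide`) equals
`ĝ(0) + ĝ(1) - Σ_p connesLocalTerm p g - connesArchPV g`. The sum over places is over the primes
(`Nat.Primes`) plus `v = ∞`. Dischargeable from `explicit_formula_holds` and
`weilArchTermBombieri_eq_weilArchTerm_holds` (see the module docstring); not discharged here.
[cite: Connes1999, App. II Thm 6 (with (9), (36), Lemmas II.2–II.3)] -/
def Connes1999_thm_6_rat : Prop :=
  ∀ g : ℝ → ℂ, IsWeilTest g →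
    (∃ A : ℂ, Tendsto (connesArchTrunc g) (𝓝[>] (0 : ℝ)) (𝓝 A)) ∧
      HasWeilZeroSide g
        (weilPolarTerm g - (∑' p : Nat.Primes, connesLocalTerm (p : ℕ) g) - connesArchPV g)

/-- Under `Connes1999_thm_6_rat`, the archimedean principal value is a genuine limit: the
`limUnder` in `connesArchPV` is attained. [cite: Connes1999, App. II (36)] -/
theorem Connes1999_thm_6_rat.tendsto_connesArchTrunc (h : Connes1999_thm_6_rat) {g : ℝ → ℂ}
    (hg : IsWeilTest g) :
    Tendsto (connesArchTrunc g) (𝓝[>] (0 : ℝ))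
      (𝓝 (connesArchPV g - (Real.log (2 * Real.pi) + Real.eulerMascheroniConstant : ℂ) * g 0)) := by
  obtain ⟨⟨A, hA⟩, -⟩ := h g hg
  have hlim : limUnder (𝓝[>] (0 : ℝ)) (connesArchTrunc g) = A := hA.limUnder_eq
  have : connesArchPV g - (Real.log (2 * Real.pi) + Real.eulerMascheroniConstant : ℂ) * g 0 = A := by
    rw [connesArchPV, hlim]; ring
  rw [this]; exact hA

/-- Under `Connes1999_thm_6_rat` and the tree's explicit formula (`explicit_formula`, PROVED as
`explicit_formula_holds`), the two right-hand sides agree: Connes' sum of local terms equals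
`weilPrimeTerm g - weilArchTerm g` (uniqueness of the limit `HasWeilZeroSide g ·`). This is the
NORMALISATION dictionary between Connes' `Σ_v ∫′` and the tree's `W`. [folklore] -/
theorem Connes1999_thm_6_rat.localTerms_eq (h : Connes1999_thm_6_rat) (hef : explicit_formula)
    {g : ℝ → ℂ} (hg : IsWeilTest g) :
    (∑' p : Nat.Primes, connesLocalTerm (p : ℕ) g) + connesArchPV g =
      weilPrimeTerm g - weilArchTerm g := by
  obtain ⟨-, hZ⟩ := h g hg
  have hW : HasWeilZeroSide g (weilFunctional g) := hef hg
  have huniq := tendsto_nhds_unique hZ hW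
  unfold weilFunctional at huniq
  linear_combination (-1 : ℂ) * huniq


/-! ## The finite places: `Σ_p ∫′_{ℚ_p*} = weilPrimeTerm` (reindexing `n = p^m`) — appended 2026-08-19 -/

/-- The summand of `connesLocalTerm p g` as a function of `(p, m)`. [folklore] -/
private def locSummand (g : ℝ → ℂ) (q : Nat.Primes × ℕ) : ℂ :=
  (Real.log (q.1 : ℕ) : ℂ) * ((((q.1 : ℕ) : ℝ) ^ (-((q.2 + 1 : ℕ) : ℝ) / 2) : ℝ) : ℂ) *
    (g ((q.2 + 1 : ℕ) * Real.log (q.1 : ℕ)) + g (-((q.2 + 1 : ℕ) * Real.log (q.1 : ℕ))))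

/-- The summand of `weilPrimeTerm g`. [folklore] -/
private def primeSummand (g : ℝ → ℂ) (n : ℕ) : ℂ :=
  ((ArithmeticFunction.vonMangoldt n : ℝ) : ℂ) / (Real.sqrt n : ℂ) * (g (Real.log n) + g (-Real.log n))

/-- The reindexing map `(p, m) ↦ p^{m+1}` onto the prime powers. [folklore] -/
private def powMap (q : Nat.Primes × ℕ) : ℕ := (q.1 : ℕ) ^ (q.2 + 1)

/-- `(p, m) ↦ p^{m+1}` is injective on primes (`Nat.Prime.pow_inj`). [folklore] -/
private theorem powMap_injective : Function.Injective powMap := by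
  rintro ⟨⟨p, hp⟩, m⟩ ⟨⟨q, hq⟩, n⟩ h
  obtain ⟨h1, h2⟩ := Nat.Prime.pow_inj hp hq h
  subst h1; subst h2; rfl

/-- Term identity at `n = p^{m+1}`: `Λ(p^{m+1}) = log p`, `√(p^{m+1}) = p^{(m+1)/2}`,
`log p^{m+1} = (m+1) log p`. [folklore] -/
private theorem primeSummand_powMap (g : ℝ → ℂ) (q : Nat.Primes × ℕ) :
    primeSummand g (powMap q) = locSummand g q := by
  obtain ⟨⟨p, hp⟩, m⟩ := q
  have hp0 : (0 : ℝ) ≤ p := by positivity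
  have hΛ : ArithmeticFunction.vonMangoldt (p ^ (m + 1)) = Real.log p := by
    rw [ArithmeticFunction.vonMangoldt_apply_pow (Nat.succ_ne_zero m),
      ArithmeticFunction.vonMangoldt_apply_prime hp]
  have hlog : Real.log (((p ^ (m + 1) : ℕ) : ℝ)) = ((m + 1 : ℕ) : ℝ) * Real.log p := by
    rw [Nat.cast_pow, Real.log_pow]
  have hsqrt : Real.sqrt (((p ^ (m + 1) : ℕ) : ℝ)) = (p : ℝ) ^ (((m + 1 : ℕ) : ℝ) / 2) := by
    rw [Nat.cast_pow, Real.sqrt_eq_rpow, ← Real.rpow_natCast, ← Real.rpow_mul hp0]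
    congr 1
    ring
  have hcoef : (Real.log p : ℂ) / (Real.sqrt (((p ^ (m + 1) : ℕ) : ℝ)) : ℂ) =
      (Real.log p : ℂ) * (((p : ℝ) ^ (-((m + 1 : ℕ) : ℝ) / 2) : ℝ) : ℂ) := by
    rw [hsqrt, neg_div, Real.rpow_neg hp0, div_eq_mul_inv, Complex.ofReal_inv]
  simp only [primeSummand, locSummand, powMap]
  rw [hΛ, hlog, hcoef]

/-- **Connes' finite-place principal values sum to the prime term of the tree**: for a Weil test
function `g`, `Σ_{p prime} ∫′_{ℚ_p*} h(u⁻¹)/|1-u|_p d*u = Σ_p connesLocalTerm p g = weilPrimeTerm g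
= Σ_n Λ(n) n^{-1/2}(g(log n) + g(-log n))` (reindexing `n = p^{m+1}`; all sums are finite since `g`
has compact support). This is the `v = p` part of the dictionary between App. II Thm 6 / Thm VII.4
and the explicit formula as normalised in `WeilExplicit.lean`. [cite: Connes1999, App. II (20)–(21) with (9) and Lemma II.2] -/
theorem tsum_connesLocalTerm_eq_weilPrimeTerm {g : ℝ → ℂ} (hg : IsWeilTest g) :
    ∑' p : Nat.Primes, connesLocalTerm (p : ℕ) g = weilPrimeTerm g := by
  -- the support of `g` is bounded
  obtain ⟨r, hr⟩ := (hg.2.isCompact.isBounded).subset_closedBall 0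
  have hgr : ∀ t : ℝ, g t ≠ 0 → |t| ≤ r := by
    intro t ht
    have := hr (subset_tsupport g ht)
    rwa [Metric.mem_closedBall, Real.dist_eq, sub_zero] at this
  -- the reindexed family has finite support
  have hfin : (Function.support (locSummand g)).Finite := by
    apply ((Set.finite_Iic ⌊Real.exp r⌋₊).preimage powMap_injective.injOn).subset
    intro q hq
    obtain ⟨⟨p, hp⟩, m⟩ := q
    simp only [Function.mem_support, ne_eq] at hq
    simp only [Set.mem_preimage, Set.mem_Iic, powMap]
    have hp1 : (1 : ℝ) < p := by exact_mod_cast hp.one_lt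
    have hlogp : 0 < Real.log p := Real.log_pos hp1
    have hval : g ((m + 1 : ℕ) * Real.log p) ≠ 0 ∨ g (-((m + 1 : ℕ) * Real.log p)) ≠ 0 := by
      by_contra hcon
      push Not at hcon
      apply hq
      simp only [locSummand, hcon.1, hcon.2, add_zero, mul_zero]
    have hle : ((m + 1 : ℕ) : ℝ) * Real.log p ≤ r := by
      rcases hval with h1 | h1
      · have := hgr _ h1
        rwa [abs_of_nonneg (by positivity)] at this
      · have := hgr _ h1
        rwa [abs_neg, abs_of_nonneg (by positivity)] at this
    apply Nat.le_floor
    rw [Nat.cast_pow, ← Real.exp_log (pow_pos (by positivity) (m + 1)), Real.log_pow]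
    exact Real.exp_le_exp.mpr hle
  have hsum : Summable (locSummand g) := summable_of_hasFiniteSupport hfin
  -- the support of the prime-term summand consists of prime powers
  have hsupp : Function.support (primeSummand g) ⊆ Set.range powMap := by
    intro n hn
    simp only [Function.mem_support, ne_eq, primeSummand] at hn
    have hΛ : ArithmeticFunction.vonMangoldt n ≠ 0 := by
      intro h0
      apply hn
      rw [h0]
      simp
    have hpp : IsPrimePow n := by
      by_contra hnot
      exact hΛ (ArithmeticFunction.vonMangoldt_eq_zero_iff.mpr hnot)
    obtain ⟨p, k, hp, hk, rfl⟩ := (isPrimePow_nat_iff n).mp hpp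
    obtain ⟨j, rfl⟩ := Nat.exists_eq_add_one_of_ne_zero hk.ne'
    exact ⟨(⟨p, hp⟩, j), rfl⟩
  calc ∑' p : Nat.Primes, connesLocalTerm (p : ℕ) g
      = ∑' (p : Nat.Primes) (m : ℕ), locSummand g (p, m) := by
        simp only [connesLocalTerm, locSummand]
    _ = ∑' q : Nat.Primes × ℕ, locSummand g q := hsum.tsum_prod.symm
    _ = ∑' q : Nat.Primes × ℕ, primeSummand g (powMap q) := by
        simp only [primeSummand_powMap]
    _ = ∑' n : ℕ, primeSummand g n := powMap_injective.tsum_eq hsupp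
    _ = weilPrimeTerm g := by simp only [primeSummand, weilPrimeTerm]

/-- Consequently (under `Connes1999_thm_6_rat` and the tree's PROVED explicit formula) Connes'
archimedean principal value is minus the tree's archimedean term: `∫′_ℝ h(u⁻¹)/|1-u| d*u
= -weilArchTerm g = (log 4π + γ) g(0) + ∫₀^∞ (e^{t/2}(g(t) + g(-t)) - 2g(0))/(2 sinh t) dt`
(Bombieri's `W_ℝ`). [folklore] -/
theorem Connes1999_thm_6_rat.connesArchPV_eq (h : Connes1999_thm_6_rat) (hef : explicit_formula)
    {g : ℝ → ℂ} (hg : IsWeilTest g) : connesArchPV g = -weilArchTerm g := by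
  have h1 := h.localTerms_eq hef hg
  rw [tsum_connesLocalTerm_eq_weilPrimeTerm hg] at h1
  linear_combination h1


/-! ## Discharge of `Connes1999_thm_6_rat` (appended 2026-08-19, cc-1 gen 2)

We follow the architecture of the source (Connes 1999, App. II, proof of Theorem 6): Weil's
explicit formula plus a comparison of principal values place by place. Weil's formula is the
tree's PROVED `explicit_formula_holds` (Bombieri's normalisation, archimedean term
`weilArchTermBombieri`, `weilArchTermBombieri_eq_weilArchTerm_holds`); the finite places are
`tsum_connesLocalTerm_eq_weilPrimeTerm` above; what remains is the archimedean comparison of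
App. II (36) with Bombieri's `W_ℝ`: after the substitutions `u = ∓e^{∓t}` the truncated integral
`∫_{|1-u| ≥ ε} f(u)/|1-u| d*u` becomes `∫ g/(4 cosh(t/2))` (from `u < 0`) plus
`∫_{t ≥ -log(1-ε)} g(t) dt/(4 sinh(t/2)) + ∫_{t ≥ log(1+ε)} g(-t) dt/(4 sinh(t/2))` (from `u > 0`);
subtracting `g(0) dt/(2 sinh t)` (primitive `½ log((1-e^{-t})/(1+e^{-t}))`) makes the integrands
integrable down to `t = 0`, and the two boundary terms are EXACTLY
`½ g(0)(log(2-ε) - log ε) + ½ g(0)(log(2+ε) - log ε)`, so that adding `(log ε) g(0)` leaves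
`½ g(0)(log(2-ε) + log(2+ε)) → g(0) log 2` ("the right hand side of (36) gives `λ - log 2`",
App. II after (36)). Finally `e^{t/2}/(2 sinh t) = 1/(4 sinh(t/2)) + 1/(4 cosh(t/2))` identifies the
limit with Bombieri's integral, whence `connesArchPV g = -weilArchTermBombieri g = -weilArchTerm g`.
-/

section ArchDischarge

variable {φ g : ℝ → ℂ}

/-! ### Hyperbolic inequalities -/

/-- `sinh t = 2 sinh(t/2) cosh(t/2)`. [folklore] -/
private theorem sinh_eq_two_mul_sinh_half (t : ℝ) :
    Real.sinh t = 2 * Real.sinh (t / 2) * Real.cosh (t / 2) := by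
  rw [← Real.sinh_two_mul]; ring_nf

/-- `cosh x - 1 ≤ sinh x` for `0 ≤ x` (`cosh x - sinh x = e^{-x} ≤ 1`). [folklore] -/
private theorem cosh_sub_one_le_sinh {x : ℝ} (hx : 0 ≤ x) : Real.cosh x - 1 ≤ Real.sinh x := by
  have h := Real.cosh_sub_sinh x
  have : Real.exp (-x) ≤ 1 := Real.exp_le_one_iff.2 (by linarith)
  linarith

/-- `e^x ≤ 2 cosh x`. [folklore] -/
private theorem exp_le_two_mul_cosh (x : ℝ) : Real.exp x ≤ 2 * Real.cosh x := by
  rw [Real.cosh_eq]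
  have := Real.exp_pos (-x)
  linarith

/-- `t/(4 sinh(t/2)) ≤ e^{-t/4}` for `t > 0` (`sinh(t/2) = 2 sinh(t/4) cosh(t/4) ≥ (t/2) cosh(t/4)
≥ (t/4) e^{t/4}`). [folklore] -/
private theorem div_four_sinh_half_le {t : ℝ} (ht : 0 < t) :
    t / (4 * Real.sinh (t / 2)) ≤ Real.exp (-(1 / 4) * t) := by
  have h1 : Real.sinh (t / 2) = 2 * Real.sinh (t / 4) * Real.cosh (t / 4) := by
    rw [← Real.sinh_two_mul]; ring_nf
  have h2 : t / 4 ≤ Real.sinh (t / 4) := Real.self_le_sinh_iff.2 (by positivity)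
  have h3 : Real.exp (t / 4) ≤ 2 * Real.cosh (t / 4) := exp_le_two_mul_cosh _
  have hcosh : 0 < Real.cosh (t / 4) := Real.cosh_pos _
  have hsinh : 0 < Real.sinh (t / 2) := Real.sinh_pos_iff.2 (by positivity)
  have hprod : Real.exp (-(1 / 4) * t) * Real.exp (t / 4) = 1 := by
    rw [← Real.exp_add]; ring_nf; exact Real.exp_zero
  rw [div_le_iff₀ (by positivity)]
  calc t = Real.exp (-(1 / 4) * t) * (t * Real.exp (t / 4)) := by
        rw [mul_comm t, ← mul_assoc, hprod, one_mul]
    _ ≤ Real.exp (-(1 / 4) * t) * (4 * Real.sinh (t / 2)) := by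
        refine mul_le_mul_of_nonneg_left ?_ (Real.exp_pos _).le
        rw [h1]
        calc t * Real.exp (t / 4) ≤ t * (2 * Real.cosh (t / 4)) :=
              mul_le_mul_of_nonneg_left h3 ht.le
          _ = 8 * (t / 4) * Real.cosh (t / 4) := by ring
          _ ≤ 8 * Real.sinh (t / 4) * Real.cosh (t / 4) := by
              have := mul_le_mul_of_nonneg_right h2 hcosh.le
              nlinarith
          _ = 4 * (2 * Real.sinh (t / 4) * Real.cosh (t / 4)) := by ring

/-- `0 ≤ 1/(4 sinh(t/2)) - 1/(2 sinh t) ≤ e^{-t/4}` for `t > 0`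
(`= (cosh(t/2) - 1)/(4 sinh(t/2) cosh(t/2)) ≤ 1/(4 cosh(t/2))`). [folklore] -/
private theorem inv_sinh_half_sub_inv_sinh_bounds {t : ℝ} (ht : 0 < t) :
    0 ≤ 1 / (4 * Real.sinh (t / 2)) - 1 / (2 * Real.sinh t) ∧
      1 / (4 * Real.sinh (t / 2)) - 1 / (2 * Real.sinh t) ≤ Real.exp (-(1 / 4) * t) := by
  have hs : 0 < Real.sinh (t / 2) := Real.sinh_pos_iff.2 (by positivity)
  have hc1 : 1 ≤ Real.cosh (t / 2) := Real.one_le_cosh _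
  have hc : 0 < Real.cosh (t / 2) := by linarith
  have hsinh : Real.sinh t = 2 * Real.sinh (t / 2) * Real.cosh (t / 2) :=
    sinh_eq_two_mul_sinh_half t
  have key : 1 / (4 * Real.sinh (t / 2)) - 1 / (2 * Real.sinh t) =
      (Real.cosh (t / 2) - 1) / (4 * Real.sinh (t / 2) * Real.cosh (t / 2)) := by
    rw [hsinh]
    field_simp
    ring
  rw [key]
  refine ⟨div_nonneg (by linarith) (by positivity), ?_⟩
  have h1 : Real.cosh (t / 2) - 1 ≤ Real.sinh (t / 2) := cosh_sub_one_le_sinh (by positivity)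
  have h2 : Real.exp (t / 2) ≤ 2 * Real.cosh (t / 2) := exp_le_two_mul_cosh _
  have hprod : Real.exp (-(1 / 4) * t) * Real.exp (t / 2) = Real.exp (t / 4) := by
    rw [← Real.exp_add]; ring_nf
  have h4 : 1 ≤ Real.exp (t / 4) := Real.one_le_exp (by positivity)
  calc (Real.cosh (t / 2) - 1) / (4 * Real.sinh (t / 2) * Real.cosh (t / 2))
      ≤ Real.sinh (t / 2) / (4 * Real.sinh (t / 2) * Real.cosh (t / 2)) := by gcongr
    _ = 1 / (4 * Real.cosh (t / 2)) := by
        field_simp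
    _ ≤ Real.exp (-(1 / 4) * t) := by
        rw [div_le_iff₀ (by positivity)]
        calc (1 : ℝ) ≤ 2 * Real.exp (t / 4) := by linarith
          _ = Real.exp (-(1 / 4) * t) * (2 * Real.exp (t / 2)) := by rw [← hprod]; ring
          _ ≤ Real.exp (-(1 / 4) * t) * (4 * Real.cosh (t / 2)) :=
              mul_le_mul_of_nonneg_left (by linarith) (Real.exp_pos _).le

/-! ### The regularised archimedean integrand `φ(t)/(4 sinh(t/2)) - φ(0)/(2 sinh t)` -/

/-- Norm bound `‖φ(t)/(4 sinh(t/2)) - φ(0)/(2 sinh t)‖ ≤ C e^{-t/4}` on `(0, ∞)` for a test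
function `φ` (`φ` is Lipschitz: `‖φ(t) - φ(0)‖ ≤ K t`). [folklore] -/
private theorem norm_archReg_le (hφ : IsWeilTest φ) :
    ∃ C : ℝ, 0 ≤ C ∧ ∀ t : ℝ, 0 < t →
      ‖((1 / (4 * Real.sinh (t / 2)) : ℝ) : ℂ) * φ t - ((1 / (2 * Real.sinh t) : ℝ) : ℂ) * φ 0‖
        ≤ C * Real.exp (-(1 / 4) * t) := by
  obtain ⟨K, hK⟩ := hφ.1.lipschitzWith_of_hasCompactSupport hφ.2 (by simp)
  refine ⟨K + ‖φ 0‖, by positivity, fun t ht ↦ ?_⟩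
  have hs : 0 < Real.sinh (t / 2) := Real.sinh_pos_iff.2 (by positivity)
  have hw1 : 0 < 1 / (4 * Real.sinh (t / 2)) := by positivity
  obtain ⟨hnn, hle⟩ := inv_sinh_half_sub_inv_sinh_bounds ht
  have hlip : ‖φ t - φ 0‖ ≤ K * t := by
    have := hK.dist_le_mul t 0
    rwa [dist_eq_norm, Real.dist_eq, sub_zero, abs_of_pos ht] at this
  have halg : ((1 / (4 * Real.sinh (t / 2)) : ℝ) : ℂ) * φ t
        - ((1 / (2 * Real.sinh t) : ℝ) : ℂ) * φ 0
      = ((1 / (4 * Real.sinh (t / 2)) : ℝ) : ℂ) * (φ t - φ 0)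
        + ((1 / (4 * Real.sinh (t / 2)) - 1 / (2 * Real.sinh t) : ℝ) : ℂ) * φ 0 := by
    push_cast
    ring
  rw [halg]
  calc ‖((1 / (4 * Real.sinh (t / 2)) : ℝ) : ℂ) * (φ t - φ 0)
        + ((1 / (4 * Real.sinh (t / 2)) - 1 / (2 * Real.sinh t) : ℝ) : ℂ) * φ 0‖
      ≤ ‖((1 / (4 * Real.sinh (t / 2)) : ℝ) : ℂ) * (φ t - φ 0)‖
        + ‖((1 / (4 * Real.sinh (t / 2)) - 1 / (2 * Real.sinh t) : ℝ) : ℂ) * φ 0‖ :=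
        norm_add_le _ _
    _ = 1 / (4 * Real.sinh (t / 2)) * ‖φ t - φ 0‖
        + (1 / (4 * Real.sinh (t / 2)) - 1 / (2 * Real.sinh t)) * ‖φ 0‖ := by
        rw [norm_mul, norm_mul, Complex.norm_real, Complex.norm_real, Real.norm_of_nonneg hw1.le,
          Real.norm_of_nonneg hnn]
    _ ≤ 1 / (4 * Real.sinh (t / 2)) * (K * t) + Real.exp (-(1 / 4) * t) * ‖φ 0‖ := by
        gcongr
    _ = K * (t / (4 * Real.sinh (t / 2))) + ‖φ 0‖ * Real.exp (-(1 / 4) * t) := by ring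
    _ ≤ K * Real.exp (-(1 / 4) * t) + ‖φ 0‖ * Real.exp (-(1 / 4) * t) := by
        gcongr
        exact div_four_sinh_half_le ht
    _ = (K + ‖φ 0‖) * Real.exp (-(1 / 4) * t) := by ring

/-- Continuity of the regularised integrand on `(0, ∞)`. [folklore] -/
private theorem continuousOn_archReg (hφ : Continuous φ) :
    ContinuousOn (fun t : ℝ ↦ ((1 / (4 * Real.sinh (t / 2)) : ℝ) : ℂ) * φ t
      - ((1 / (2 * Real.sinh t) : ℝ) : ℂ) * φ 0) (Ioi 0) := by
  refine ContinuousOn.sub (ContinuousOn.mul ?_ hφ.continuousOn)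
    (ContinuousOn.mul ?_ continuousOn_const)
  · refine Complex.continuous_ofReal.comp_continuousOn
      (ContinuousOn.div continuousOn_const (by fun_prop) fun t ht ↦ ?_)
    have : 0 < Real.sinh (t / 2) := Real.sinh_pos_iff.2 (by simpa using half_pos (α := ℝ) ht)
    positivity
  · refine Complex.continuous_ofReal.comp_continuousOn
      (ContinuousOn.div continuousOn_const (by fun_prop) fun t ht ↦ ?_)
    have : 0 < Real.sinh t := Real.sinh_pos_iff.2 ht
    positivity

/-- **Integrability of the regularised archimedean integrand** `φ(t)/(4 sinh(t/2)) - φ(0)/(2 sinh t)`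
on `(0, ∞)`, for a test function `φ`. [folklore] -/
private theorem integrableOn_archReg (hφ : IsWeilTest φ) :
    IntegrableOn (fun t : ℝ ↦ ((1 / (4 * Real.sinh (t / 2)) : ℝ) : ℂ) * φ t
      - ((1 / (2 * Real.sinh t) : ℝ) : ℂ) * φ 0) (Ioi 0) := by
  obtain ⟨C, -, hC⟩ := norm_archReg_le hφ
  refine Integrable.mono' ((exp_neg_integrableOn_Ioi 0 (by norm_num : (0 : ℝ) < 1 / 4)).const_mul C)
    ((continuousOn_archReg hφ.1.continuous).aestronglyMeasurable measurableSet_Ioi) ?_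
  exact (ae_restrict_iff' measurableSet_Ioi).2 (Eventually.of_forall fun t ht ↦ hC t ht)

/-! ### `∫_a^∞ dt/(2 sinh t)` -/

/-- For `a > 0`: `t ↦ 1/(2 sinh t)` is integrable on `(a, ∞)` and
`∫_a^∞ dt/(2 sinh t) = ½ (log(1 + e^{-a}) - log(1 - e^{-a}))` (primitive
`½ (log(1 - e^{-t}) - log(1 + e^{-t})) = ½ log tanh(t/2)`). [folklore] -/
private theorem integral_inv_two_sinh {a : ℝ} (ha : 0 < a) :
    IntegrableOn (fun t : ℝ ↦ 1 / (2 * Real.sinh t)) (Ioi a) ∧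
      ∫ t in Ioi a, 1 / (2 * Real.sinh t) =
        1 / 2 * (Real.log (1 + Real.exp (-a)) - Real.log (1 - Real.exp (-a))) := by
  set G : ℝ → ℝ := fun t ↦ 1 / 2 * (Real.log (1 - Real.exp (-t)) - Real.log (1 + Real.exp (-t)))
    with hG
  have hderiv : ∀ t ∈ Ici a, HasDerivAt G (1 / (2 * Real.sinh t)) t := by
    intro t ht
    have ht0 : 0 < t := lt_of_lt_of_le ha ht
    have he : HasDerivAt (fun s : ℝ ↦ Real.exp (-s)) (-Real.exp (-t)) t :=
      ((hasDerivAt_neg t).exp).congr_deriv (by ring)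
    have hq1 : Real.exp (-t) < 1 := Real.exp_lt_one_iff.2 (by linarith)
    have hq0 : 0 < Real.exp (-t) := Real.exp_pos _
    have h1 : 0 < 1 - Real.exp (-t) := by linarith
    have h2 : 0 < 1 + Real.exp (-t) := by positivity
    have hA : HasDerivAt (fun s : ℝ ↦ Real.log (1 - Real.exp (-s)))
        ((0 - -Real.exp (-t)) / (1 - Real.exp (-t))) t :=
      ((hasDerivAt_const t (1 : ℝ)).sub he).log h1.ne'
    have hB : HasDerivAt (fun s : ℝ ↦ Real.log (1 + Real.exp (-s)))
        ((0 + -Real.exp (-t)) / (1 + Real.exp (-t))) t :=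
      ((hasDerivAt_const t (1 : ℝ)).add he).log h2.ne'
    have hGd := (hA.sub hB).const_mul (1 / 2 : ℝ)
    have hsq : Real.exp (-(2 * t)) = Real.exp (-t) ^ 2 := by
      rw [sq, ← Real.exp_add]; ring_nf
    have hval : (1 / 2 : ℝ) * ((0 - -Real.exp (-t)) / (1 - Real.exp (-t))
        - (0 + -Real.exp (-t)) / (1 + Real.exp (-t))) = 1 / (2 * Real.sinh t) := by
      rw [← exp_neg_div_one_sub_exp ht0, hsq]
      have h3 : 1 - Real.exp (-t) ^ 2 ≠ 0 := by nlinarith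
      field_simp
      ring
    rw [hval] at hGd
    exact hGd
  have hpos : ∀ t ∈ Ioi a, 0 ≤ 1 / (2 * Real.sinh t) := fun t ht ↦ by
    have : 0 < Real.sinh t := Real.sinh_pos_iff.2 (ha.trans ht)
    positivity
  have hlim : Tendsto G atTop (𝓝 0) := by
    have he0 : Tendsto (fun t : ℝ ↦ Real.exp (-t)) atTop (𝓝 0) :=
      Real.tendsto_exp_neg_atTop_nhds_zero
    have h := (((tendsto_const_nhds (x := (1 : ℝ))).sub he0).log (by simp)).sub
      (((tendsto_const_nhds (x := (1 : ℝ))).add he0).log (by simp)) |>.const_mul (1 / 2 : ℝ)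
    simpa [hG] using h
  refine ⟨integrableOn_Ioi_deriv_of_nonneg' hderiv hpos hlim, ?_⟩
  rw [integral_Ioi_of_hasDerivAt_of_nonneg' hderiv hpos hlim, hG]
  ring


/-! ### Splitting off the boundary term and continuity at `a → 0⁺` -/

/-- For `a > 0` and a test function `φ`:
`∫_a^∞ φ(t) dt/(4 sinh(t/2)) = ∫_a^∞ (φ(t)/(4 sinh(t/2)) - φ(0)/(2 sinh t)) dt
  + ½ (log(1 + e^{-a}) - log(1 - e^{-a})) φ(0)` (and the left integrand is integrable on `(a, ∞)`).
[folklore] -/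
private theorem integral_Ioi_sinh_weight (hφ : IsWeilTest φ) {a : ℝ} (ha : 0 < a) :
    IntegrableOn (fun t : ℝ ↦ ((1 / (4 * Real.sinh (t / 2)) : ℝ) : ℂ) * φ t) (Ioi a) ∧
      ∫ t in Ioi a, ((1 / (4 * Real.sinh (t / 2)) : ℝ) : ℂ) * φ t =
        (∫ t in Ioi a, (((1 / (4 * Real.sinh (t / 2)) : ℝ) : ℂ) * φ t
            - ((1 / (2 * Real.sinh t) : ℝ) : ℂ) * φ 0)) +
          ((1 / 2 * (Real.log (1 + Real.exp (-a)) - Real.log (1 - Real.exp (-a))) : ℝ) : ℂ)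
            * φ 0 := by
  obtain ⟨hint, hval⟩ := integral_inv_two_sinh ha
  have hF : IntegrableOn (fun t : ℝ ↦ ((1 / (4 * Real.sinh (t / 2)) : ℝ) : ℂ) * φ t
      - ((1 / (2 * Real.sinh t) : ℝ) : ℂ) * φ 0) (Ioi a) :=
    (integrableOn_archReg hφ).mono_set (Ioi_subset_Ioi ha.le)
  have hW : IntegrableOn (fun t : ℝ ↦ ((1 / (2 * Real.sinh t) : ℝ) : ℂ) * φ 0) (Ioi a) :=
    hint.ofReal.mul_const _
  have hsum : (fun t : ℝ ↦ ((1 / (4 * Real.sinh (t / 2)) : ℝ) : ℂ) * φ t) =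
      fun t : ℝ ↦ (((1 / (4 * Real.sinh (t / 2)) : ℝ) : ℂ) * φ t
        - ((1 / (2 * Real.sinh t) : ℝ) : ℂ) * φ 0) + ((1 / (2 * Real.sinh t) : ℝ) : ℂ) * φ 0 := by
    funext t; ring
  refine ⟨by rw [hsum]; exact hF.add hW, ?_⟩
  rw [hsum, integral_add hF hW, integral_mul_const, integral_complex_ofReal, hval]

/-- Right-continuity at `0`: `∫_a^∞ (φ(t)/(4 sinh(t/2)) - φ(0)/(2 sinh t)) dt → ∫_0^∞ (same)` as
`a → 0⁺` (the integrand is bounded on `(0, ∞)`). [folklore] -/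
private theorem tendsto_integral_Ioi_archReg (hφ : IsWeilTest φ) :
    Tendsto (fun a : ℝ ↦ ∫ t in Ioi a, (((1 / (4 * Real.sinh (t / 2)) : ℝ) : ℂ) * φ t
        - ((1 / (2 * Real.sinh t) : ℝ) : ℂ) * φ 0)) (𝓝[>] 0)
      (𝓝 (∫ t in Ioi 0, (((1 / (4 * Real.sinh (t / 2)) : ℝ) : ℂ) * φ t
        - ((1 / (2 * Real.sinh t) : ℝ) : ℂ) * φ 0))) := by
  obtain ⟨C, hC0, hC⟩ := norm_archReg_le hφ
  have hint := integrableOn_archReg hφ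
  set F : ℝ → ℂ := fun t ↦ ((1 / (4 * Real.sinh (t / 2)) : ℝ) : ℂ) * φ t
      - ((1 / (2 * Real.sinh t) : ℝ) : ℂ) * φ 0 with hFdef
  have hsplit : ∀ a : ℝ, 0 < a →
      ∫ t in Ioi 0, F t = (∫ t in Ioc 0 a, F t) + ∫ t in Ioi a, F t := by
    intro a ha
    rw [← setIntegral_union Ioc_disjoint_Ioi_same measurableSet_Ioi
      (hint.mono_set Ioc_subset_Ioi_self) (hint.mono_set (Ioi_subset_Ioi ha.le)),
      Ioc_union_Ioi_eq_Ioi ha.le]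
  have hbound : ∀ a : ℝ, 0 < a → ‖∫ t in Ioc 0 a, F t‖ ≤ C * a := by
    intro a ha
    have h := norm_setIntegral_le_of_norm_le_const (μ := volume) (s := Ioc 0 a) (f := F)
      (C := C) measure_Ioc_lt_top fun t ht ↦ ?_
    · rwa [Real.volume_real_Ioc_of_le ha.le, sub_zero] at h
    · calc ‖F t‖ ≤ C * Real.exp (-(1 / 4) * t) := hC t ht.1
        _ ≤ C * 1 := by
            gcongr
            exact Real.exp_le_one_iff.2 (by nlinarith [ht.1])
        _ = C := mul_one C
  rw [tendsto_iff_norm_sub_tendsto_zero]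
  refine squeeze_zero' (g := fun a : ℝ ↦ C * a) (Eventually.of_forall fun a ↦ norm_nonneg _) ?_ ?_
  · filter_upwards [self_mem_nhdsWithin] with a (ha : 0 < a)
    rw [hsplit a ha, show (∫ t in Ioi a, F t) - ((∫ t in Ioc 0 a, F t) + ∫ t in Ioi a, F t)
      = -∫ t in Ioc 0 a, F t by ring, norm_neg]
    exact hbound a ha
  · have : Tendsto (fun a : ℝ ↦ C * a) (𝓝 0) (𝓝 (C * 0)) :=
      tendsto_const_nhds.mul tendsto_id
    rw [mul_zero] at this
    exact this.mono_left nhdsWithin_le_nhds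

/-! ### The three substitutions `u = -e^{-t}`, `u = e^{-t}`, `u = e^{t}` -/

/-- `u < 0`: with `u = -e^{-t}` (`t ∈ ℝ`, `|du| = e^{-t} dt`),
`|u|^{1/2}/(|1-u| 2|u|) g(-log|u|) |du| = g(t) dt/(4 cosh(t/2))`. [folklore] -/
private theorem archSubst_neg (g : ℝ → ℂ) :
    (IntegrableOn (fun u : ℝ ↦ (((|u| ^ (1 / 2 : ℝ)) / |1 - u| / (2 * |u|) : ℝ) : ℂ) *
        g (-Real.log |u|)) (Iio 0) ↔
      Integrable fun t : ℝ ↦ ((1 / (4 * Real.cosh (t / 2)) : ℝ) : ℂ) * g t) ∧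
    ∫ u in Iio 0, (((|u| ^ (1 / 2 : ℝ)) / |1 - u| / (2 * |u|) : ℝ) : ℂ) * g (-Real.log |u|) =
      ∫ t, ((1 / (4 * Real.cosh (t / 2)) : ℝ) : ℂ) * g t := by
  set f : ℝ → ℝ := fun t ↦ -Real.exp (-t) with hf
  have hderiv : ∀ t ∈ (univ : Set ℝ), HasDerivWithinAt f (Real.exp (-t)) univ t := fun t _ ↦
    (((hasDerivAt_neg t).exp).neg.congr_deriv (by ring)).hasDerivWithinAt
  have hinj : InjOn f univ := fun x _ y _ h ↦ by
    have := Real.exp_injective (neg_injective h)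
    linarith
  have himg : f '' univ = Iio 0 := by
    rw [image_univ]
    ext u
    constructor
    · rintro ⟨t, rfl⟩
      exact neg_neg_iff_pos.2 (Real.exp_pos _)
    · intro hu
      refine ⟨-Real.log (-u), ?_⟩
      show -Real.exp (-(-Real.log (-u))) = u
      rw [neg_neg, Real.exp_log (neg_pos.2 hu), neg_neg]
  have hpt : ∀ t : ℝ, |Real.exp (-t)| • ((((|f t| ^ (1 / 2 : ℝ)) / |1 - f t| / (2 * |f t|) : ℝ) : ℂ)
      * g (-Real.log |f t|)) = ((1 / (4 * Real.cosh (t / 2)) : ℝ) : ℂ) * g t := by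
    intro t
    have he : 0 < Real.exp (-t) := Real.exp_pos _
    have habs : |f t| = Real.exp (-t) := by rw [hf]; simp [abs_of_pos he]
    have h1u : |1 - f t| = 1 + Real.exp (-t) := by
      rw [hf]; simp only [sub_neg_eq_add]; exact abs_of_pos (by positivity)
    rw [habs, h1u, Real.log_exp, neg_neg, abs_of_pos he, Complex.real_smul, ← mul_assoc,
      ← Complex.ofReal_mul]
    congr 2
    have e1 : Real.exp (-t) ^ (1 / 2 : ℝ) = Real.exp (-(t / 2)) := by
      rw [← Real.exp_mul]; ring_nf
    have e2 : Real.exp (-(t / 2)) * Real.exp (t / 2) = 1 := by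
      rw [← Real.exp_add]; simp
    have e3 : Real.exp (-t) = Real.exp (-(t / 2)) * Real.exp (-(t / 2)) := by
      rw [← Real.exp_add]; ring_nf
    have hc : 0 < Real.cosh (t / 2) := Real.cosh_pos _
    have hD : (1 + Real.exp (-t)) * (2 * Real.exp (-t)) ≠ 0 := by positivity
    have h4 : 4 * Real.cosh (t / 2) ≠ 0 := by positivity
    rw [div_div, ← mul_div_assoc, div_eq_div_iff hD h4, Real.cosh_eq, e1]
    linear_combination (2 * Real.exp (-t)) * e2 - (2 * Real.exp (-t)) * e3
  refine ⟨?_, ?_⟩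
  · rw [← himg, integrableOn_image_iff_integrableOn_abs_deriv_smul MeasurableSet.univ hderiv hinj,
      integrableOn_univ]
    simp_rw [hpt]
  · rw [← himg, integral_image_eq_integral_abs_deriv_smul MeasurableSet.univ hderiv hinj,
      setIntegral_univ]
    simp_rw [hpt]

/-- `0 < u ≤ b < 1`: with `u = e^{-t}` (`t ≥ -log b > 0`),
`|u|^{1/2}/(|1-u| 2|u|) g(-log|u|) |du| = g(t) dt/(4 sinh(t/2))`. [folklore] -/
private theorem archSubst_pos_small (g : ℝ → ℂ) {b : ℝ} (hb : 0 < b) (hb1 : b < 1) :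
    (IntegrableOn (fun u : ℝ ↦ (((|u| ^ (1 / 2 : ℝ)) / |1 - u| / (2 * |u|) : ℝ) : ℂ) *
        g (-Real.log |u|)) (Ioc 0 b) ↔
      IntegrableOn (fun t : ℝ ↦ ((1 / (4 * Real.sinh (t / 2)) : ℝ) : ℂ) * g t)
        (Ici (-Real.log b))) ∧
    ∫ u in Ioc 0 b, (((|u| ^ (1 / 2 : ℝ)) / |1 - u| / (2 * |u|) : ℝ) : ℂ) * g (-Real.log |u|) =
      ∫ t in Ici (-Real.log b), ((1 / (4 * Real.sinh (t / 2)) : ℝ) : ℂ) * g t := by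
  set A : ℝ := -Real.log b with hA
  have hA0 : 0 < A := neg_pos.2 (Real.log_neg hb hb1)
  set f : ℝ → ℝ := fun t ↦ Real.exp (-t) with hf
  have hderiv : ∀ t ∈ Ici A, HasDerivWithinAt f (-Real.exp (-t)) (Ici A) t := fun t _ ↦
    (((hasDerivAt_neg t).exp).congr_deriv (by ring)).hasDerivWithinAt
  have hinj : InjOn f (Ici A) := fun x _ y _ h ↦ by
    have := Real.exp_injective h
    linarith
  have himg : f '' Ici A = Ioc 0 b := by
    ext u
    constructor
    · rintro ⟨t, ht, rfl⟩
      refine ⟨Real.exp_pos _, ?_⟩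
      calc f t = Real.exp (-t) := rfl
        _ ≤ Real.exp (-A) := Real.exp_le_exp.2 (neg_le_neg ht)
        _ = b := by rw [hA, neg_neg, Real.exp_log hb]
    · rintro ⟨hu0, hub⟩
      refine ⟨-Real.log u, ?_, by simp [hf, Real.exp_log hu0]⟩
      exact neg_le_neg (Real.log_le_log hu0 hub)
  have hpt : ∀ t ∈ Ici A, |-Real.exp (-t)| • ((((|f t| ^ (1 / 2 : ℝ)) / |1 - f t| / (2 * |f t|)
      : ℝ) : ℂ) * g (-Real.log |f t|)) = ((1 / (4 * Real.sinh (t / 2)) : ℝ) : ℂ) * g t := by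
    intro t ht
    have ht0 : 0 < t := hA0.trans_le ht
    have he : 0 < Real.exp (-t) := Real.exp_pos _
    have he1 : Real.exp (-t) < 1 := Real.exp_lt_one_iff.2 (by linarith)
    have habs : |f t| = Real.exp (-t) := abs_of_pos he
    have h1u : |1 - f t| = 1 - Real.exp (-t) := abs_of_pos (by rw [hf]; linarith)
    rw [habs, h1u, Real.log_exp, neg_neg, abs_neg, abs_of_pos he, Complex.real_smul, ← mul_assoc,
      ← Complex.ofReal_mul]
    congr 2
    have e1 : Real.exp (-t) ^ (1 / 2 : ℝ) = Real.exp (-(t / 2)) := by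
      rw [← Real.exp_mul]; ring_nf
    have e2 : Real.exp (-(t / 2)) * Real.exp (t / 2) = 1 := by
      rw [← Real.exp_add]; simp
    have e3 : Real.exp (-t) = Real.exp (-(t / 2)) * Real.exp (-(t / 2)) := by
      rw [← Real.exp_add]; ring_nf
    have hsinh : 0 < Real.sinh (t / 2) := Real.sinh_pos_iff.2 (by positivity)
    have hD : (1 - Real.exp (-t)) * (2 * Real.exp (-t)) ≠ 0 :=
      mul_ne_zero (by linarith) (by positivity)
    have h4 : 4 * Real.sinh (t / 2) ≠ 0 := by positivity
    rw [div_div, ← mul_div_assoc, div_eq_div_iff hD h4, Real.sinh_eq, e1]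
    linear_combination (2 * Real.exp (-t)) * e2 + (2 * Real.exp (-t)) * e3
  refine ⟨?_, ?_⟩
  · rw [← himg, integrableOn_image_iff_integrableOn_abs_deriv_smul measurableSet_Ici hderiv hinj]
    exact integrableOn_congr_fun hpt measurableSet_Ici
  · rw [← himg, integral_image_eq_integral_abs_deriv_smul measurableSet_Ici hderiv hinj]
    exact setIntegral_congr_fun measurableSet_Ici hpt

/-- `u ≥ c > 1`: with `u = e^{t}` (`t ≥ log c > 0`),
`|u|^{1/2}/(|1-u| 2|u|) g(-log|u|) |du| = g(-t) dt/(4 sinh(t/2))`. [folklore] -/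
private theorem archSubst_pos_large (g : ℝ → ℂ) {c : ℝ} (hc : 1 < c) :
    (IntegrableOn (fun u : ℝ ↦ (((|u| ^ (1 / 2 : ℝ)) / |1 - u| / (2 * |u|) : ℝ) : ℂ) *
        g (-Real.log |u|)) (Ici c) ↔
      IntegrableOn (fun t : ℝ ↦ ((1 / (4 * Real.sinh (t / 2)) : ℝ) : ℂ) * g (-t))
        (Ici (Real.log c))) ∧
    ∫ u in Ici c, (((|u| ^ (1 / 2 : ℝ)) / |1 - u| / (2 * |u|) : ℝ) : ℂ) * g (-Real.log |u|) =
      ∫ t in Ici (Real.log c), ((1 / (4 * Real.sinh (t / 2)) : ℝ) : ℂ) * g (-t) := by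
  set A : ℝ := Real.log c with hA
  have hc0 : 0 < c := by linarith
  have hA0 : 0 < A := Real.log_pos hc
  set f : ℝ → ℝ := fun t ↦ Real.exp t with hf
  have hderiv : ∀ t ∈ Ici A, HasDerivWithinAt f (Real.exp t) (Ici A) t := fun t _ ↦
    (Real.hasDerivAt_exp t).hasDerivWithinAt
  have hinj : InjOn f (Ici A) := fun x _ y _ h ↦ Real.exp_injective h
  have himg : f '' Ici A = Ici c := by
    ext u
    constructor
    · rintro ⟨t, ht, rfl⟩
      calc c = Real.exp A := by rw [hA, Real.exp_log hc0]
        _ ≤ f t := Real.exp_le_exp.2 ht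
    · intro hu
      have hu0 : 0 < u := hc0.trans_le hu
      exact ⟨Real.log u, Real.log_le_log hc0 hu, by simp [hf, Real.exp_log hu0]⟩
  have hpt : ∀ t ∈ Ici A, |Real.exp t| • ((((|f t| ^ (1 / 2 : ℝ)) / |1 - f t| / (2 * |f t|)
      : ℝ) : ℂ) * g (-Real.log |f t|)) = ((1 / (4 * Real.sinh (t / 2)) : ℝ) : ℂ) * g (-t) := by
    intro t ht
    have ht0 : 0 < t := hA0.trans_le ht
    have he : 0 < Real.exp t := Real.exp_pos _
    have he1 : 1 < Real.exp t := Real.one_lt_exp_iff.2 ht0  -- name?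
    have habs : |f t| = Real.exp t := abs_of_pos he
    have h1u : |1 - f t| = Real.exp t - 1 := by
      rw [abs_sub_comm]; exact abs_of_pos (by rw [hf]; linarith)
    rw [habs, h1u, Real.log_exp, Complex.real_smul, ← mul_assoc, ← Complex.ofReal_mul]
    congr 2
    have e1 : Real.exp t ^ (1 / 2 : ℝ) = Real.exp (t / 2) := by
      rw [← Real.exp_mul]; ring_nf
    have e2 : Real.exp (-(t / 2)) * Real.exp (t / 2) = 1 := by
      rw [← Real.exp_add]; simp
    have e3 : Real.exp t = Real.exp (t / 2) * Real.exp (t / 2) := by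
      rw [← Real.exp_add]; ring_nf
    have hsinh : 0 < Real.sinh (t / 2) := Real.sinh_pos_iff.2 (by positivity)
    have hD : (Real.exp t - 1) * (2 * Real.exp t) ≠ 0 :=
      mul_ne_zero (by linarith) (by positivity)
    have h4 : 4 * Real.sinh (t / 2) ≠ 0 := by positivity
    rw [div_div, ← mul_div_assoc, div_eq_div_iff hD h4, Real.sinh_eq, e1]
    linear_combination (-2 * Real.exp t) * e3 + (-2 * Real.exp t) * e2
  refine ⟨?_, ?_⟩
  · rw [← himg, integrableOn_image_iff_integrableOn_abs_deriv_smul measurableSet_Ici hderiv hinj]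
    exact integrableOn_congr_fun hpt measurableSet_Ici
  · rw [← himg, integral_image_eq_integral_abs_deriv_smul measurableSet_Ici hderiv hinj]
    exact setIntegral_congr_fun measurableSet_Ici hpt


/-- Continuity of the weight `1/(4 cosh(t/2))` (as a complex-valued function). [folklore] -/
private theorem continuous_cosh_weight :
    Continuous fun t : ℝ ↦ ((1 / (4 * Real.cosh (t / 2)) : ℝ) : ℂ) :=
  Complex.continuous_ofReal.comp
    (Continuous.div continuous_const (by fun_prop) fun t ↦ by positivity)

/-! ### The truncated integral for `0 < ε < 1` -/

/-- **App. II (36) in closed form.** For a test function `g` and `0 < ε < 1`: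
`∫_{|1-u| ≥ ε} |u|^{1/2} g(-log|u|)/(|1-u| 2|u|) du + (log ε) g(0)
  = ∫ g/(4 cosh(t/2)) + ∫_{-log(1-ε)}^∞ (g(t)/(4 sinh(t/2)) - g(0)/(2 sinh t))
    + ∫_{log(1+ε)}^∞ (g(-t)/(4 sinh(t/2)) - g(0)/(2 sinh t)) + ½ (log(2-ε) + log(2+ε)) g(0)`.
[cite: Connes1999, App. II (36)] -/
private theorem connesArchTrunc_eq (hg : IsWeilTest g) {ε : ℝ} (hε : 0 < ε) (hε1 : ε < 1) :
    connesArchTrunc g ε =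
      (∫ t, ((1 / (4 * Real.cosh (t / 2)) : ℝ) : ℂ) * g t)
      + (∫ t in Ioi (-Real.log (1 - ε)), (((1 / (4 * Real.sinh (t / 2)) : ℝ) : ℂ) * g t
          - ((1 / (2 * Real.sinh t) : ℝ) : ℂ) * g 0))
      + (∫ t in Ioi (Real.log (1 + ε)), (((1 / (4 * Real.sinh (t / 2)) : ℝ) : ℂ) * g (-t)
          - ((1 / (2 * Real.sinh t) : ℝ) : ℂ) * g 0))
      + ((1 / 2 * (Real.log (2 - ε) + Real.log (2 + ε)) : ℝ) : ℂ) * g 0 := by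
  have hg' : IsWeilTest (fun t ↦ g (-t)) := hg.comp_neg
  set K : ℝ → ℂ := fun u ↦ (((|u| ^ (1 / 2 : ℝ)) / |1 - u| / (2 * |u|) : ℝ) : ℂ) *
    g (-Real.log |u|) with hK
  have h1ε : 0 < 1 - ε := by linarith
  have h1ε' : 1 - ε < 1 := by linarith
  have h2ε : 1 < 1 + ε := by linarith
  have ha2 : 0 < -Real.log (1 - ε) := neg_pos.2 (Real.log_neg h1ε h1ε')
  have ha1 : 0 < Real.log (1 + ε) := Real.log_pos h2ε
  -- the three pieces in the `u`-variable
  obtain ⟨hAi, hAv⟩ := archSubst_neg g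
  obtain ⟨hBi, hBv⟩ := archSubst_pos_small g h1ε h1ε'
  obtain ⟨hCi, hCv⟩ := archSubst_pos_large g h2ε
  -- integrability in the `t`-variable
  have hcoshI : Integrable fun t : ℝ ↦ ((1 / (4 * Real.cosh (t / 2)) : ℝ) : ℂ) * g t :=
    (continuous_cosh_weight.mul hg.1.continuous).integrable_of_hasCompactSupport hg.2.mul_left
  obtain ⟨hBI, hBV⟩ := integral_Ioi_sinh_weight hg ha2
  obtain ⟨hCI, hCV⟩ := integral_Ioi_sinh_weight hg' ha1
  have hKA : IntegrableOn K (Iio 0) := hAi.2 hcoshI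
  have hKB : IntegrableOn K (Ioc 0 (1 - ε)) := hBi.2 (hBI.congr_set_ae Ioi_ae_eq_Ici.symm)
  have hKC : IntegrableOn K (Ici (1 + ε)) := hCi.2 (hCI.congr_set_ae Ioi_ae_eq_Ici.symm)
  have hKA' : IntegrableOn K (Iic 0) := hKA.congr_set_ae Iio_ae_eq_Iic.symm
  -- the domain
  have hS : {u : ℝ | ε ≤ |1 - u|} = Iic (1 - ε) ∪ Ici (1 + ε) := by
    ext u
    simp only [mem_setOf_eq, mem_union, mem_Iic, mem_Ici]
    rw [le_abs']
    constructor
    · rintro (h | h)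
      · right; linarith
      · left; linarith
    · rintro (h | h)
      · right; linarith
      · left; linarith
  have hdisj1 : Disjoint (Iic (1 - ε)) (Ici (1 + ε)) :=
    disjoint_left.2 fun u (hu : u ≤ 1 - ε) (hu' : 1 + ε ≤ u) ↦ by linarith
  have hdisj2 : Disjoint (Iic (0 : ℝ)) (Ioc 0 (1 - ε)) :=
    disjoint_left.2 fun u (hu : u ≤ 0) hu' ↦ by linarith [hu'.1]
  have hKAB : IntegrableOn K (Iic (1 - ε)) := by
    rw [← Iic_union_Ioc_eq_Iic h1ε.le]; exact hKA'.union hKB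
  have hint : ∫ u in {u : ℝ | ε ≤ |1 - u|}, K u =
      (∫ u in Iio 0, K u) + (∫ u in Ioc 0 (1 - ε), K u) + ∫ u in Ici (1 + ε), K u := by
    rw [hS, setIntegral_union hdisj1 measurableSet_Ici hKAB hKC, ← Iic_union_Ioc_eq_Iic h1ε.le,
      setIntegral_union hdisj2 measurableSet_Ioc hKA' hKB, integral_Iic_eq_integral_Iio]
  -- the boundary values
  have hexp2 : Real.exp (-(-Real.log (1 - ε))) = 1 - ε := by rw [neg_neg, Real.exp_log h1ε]
  have hexp1 : Real.exp (-Real.log (1 + ε)) = (1 + ε)⁻¹ := by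
    rw [Real.exp_neg, Real.exp_log (by linarith)]
  have hlog2 : 1 / 2 * (Real.log (1 + (1 - ε)) - Real.log (1 - (1 - ε))) =
      1 / 2 * (Real.log (2 - ε) - Real.log ε) := by
    congr 3 <;> ring
  have hlog1 : 1 / 2 * (Real.log (1 + (1 + ε)⁻¹) - Real.log (1 - (1 + ε)⁻¹)) =
      1 / 2 * (Real.log (2 + ε) - Real.log ε) := by
    have hne : (1 + ε) ≠ 0 := by linarith
    have e1 : 1 + (1 + ε)⁻¹ = (2 + ε) / (1 + ε) := by field_simp; ring
    have e2 : 1 - (1 + ε)⁻¹ = ε / (1 + ε) := by field_simp; ring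
    rw [e1, e2, Real.log_div (by linarith) hne, Real.log_div hε.ne' hne]
    ring
  unfold connesArchTrunc
  rw [hint, hAv, hBv, hCv, integral_Ici_eq_integral_Ioi, integral_Ici_eq_integral_Ioi, hBV, hCV,
    hexp2, hexp1, hlog2, hlog1]
  simp only [neg_zero]
  push_cast
  ring

/-- **The `ε → 0⁺` limit of App. II (36) exists**, and equals
`∫ g/(4 cosh(t/2)) + ∫₀^∞ (g(t)/(4 sinh(t/2)) - g(0)/(2 sinh t)) + ∫₀^∞ (g(-t)/(4 sinh(t/2)) - g(0)/(2 sinh t))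
 + (log 2) g(0)`. [cite: Connes1999, App. II (36)] -/
private theorem tendsto_connesArchTrunc' (hg : IsWeilTest g) :
    Tendsto (connesArchTrunc g) (𝓝[>] 0)
      (𝓝 ((∫ t, ((1 / (4 * Real.cosh (t / 2)) : ℝ) : ℂ) * g t)
        + (∫ t in Ioi 0, (((1 / (4 * Real.sinh (t / 2)) : ℝ) : ℂ) * g t
            - ((1 / (2 * Real.sinh t) : ℝ) : ℂ) * g 0))
        + (∫ t in Ioi 0, (((1 / (4 * Real.sinh (t / 2)) : ℝ) : ℂ) * g (-t)
            - ((1 / (2 * Real.sinh t) : ℝ) : ℂ) * g 0))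
        + ((Real.log 2 : ℝ) : ℂ) * g 0)) := by
  have hg' : IsWeilTest (fun t ↦ g (-t)) := hg.comp_neg
  have hev : ∀ᶠ ε in 𝓝[>] (0 : ℝ), connesArchTrunc g ε =
      (∫ t, ((1 / (4 * Real.cosh (t / 2)) : ℝ) : ℂ) * g t)
      + (∫ t in Ioi (-Real.log (1 - ε)), (((1 / (4 * Real.sinh (t / 2)) : ℝ) : ℂ) * g t
          - ((1 / (2 * Real.sinh t) : ℝ) : ℂ) * g 0))
      + (∫ t in Ioi (Real.log (1 + ε)), (((1 / (4 * Real.sinh (t / 2)) : ℝ) : ℂ) * g (-t)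
          - ((1 / (2 * Real.sinh t) : ℝ) : ℂ) * g 0))
      + ((1 / 2 * (Real.log (2 - ε) + Real.log (2 + ε)) : ℝ) : ℂ) * g 0 := by
    filter_upwards [Ioo_mem_nhdsGT (zero_lt_one' ℝ)] with ε hε
    exact connesArchTrunc_eq hg hε.1 hε.2
  refine Tendsto.congr' (EventuallyEq.symm hev) ?_
  refine ((tendsto_const_nhds.add ?_).add ?_).add ?_
  · have ha : Tendsto (fun ε : ℝ ↦ -Real.log (1 - ε)) (𝓝[>] 0) (𝓝[>] 0) := by
      refine tendsto_nhdsWithin_iff.2 ⟨?_, ?_⟩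
      · have h : Tendsto (fun ε : ℝ ↦ -Real.log (1 - ε)) (𝓝 0) (𝓝 (-Real.log (1 - 0))) :=
          (((tendsto_const_nhds (x := (1 : ℝ))).sub tendsto_id).log (by simp)).neg
        simp only [sub_zero, Real.log_one, neg_zero] at h
        exact h.mono_left nhdsWithin_le_nhds
      · filter_upwards [Ioo_mem_nhdsGT (zero_lt_one' ℝ)] with ε hε
        exact neg_pos.2 (Real.log_neg (by linarith [hε.2]) (by linarith [hε.1]))
    exact (tendsto_integral_Ioi_archReg hg).comp ha
  · have ha : Tendsto (fun ε : ℝ ↦ Real.log (1 + ε)) (𝓝[>] 0) (𝓝[>] 0) := by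
      refine tendsto_nhdsWithin_iff.2 ⟨?_, ?_⟩
      · have h : Tendsto (fun ε : ℝ ↦ Real.log (1 + ε)) (𝓝 0) (𝓝 (Real.log (1 + 0))) :=
          ((tendsto_const_nhds (x := (1 : ℝ))).add tendsto_id).log (by simp)
        simp only [add_zero, Real.log_one] at h
        exact h.mono_left nhdsWithin_le_nhds
      · filter_upwards [self_mem_nhdsWithin] with ε (hε : 0 < ε)
        exact Real.log_pos (by linarith)
    have := (tendsto_integral_Ioi_archReg hg').comp ha
    simp only [neg_zero, Function.comp_def] at this
    exact this
  · have h : Tendsto (fun ε : ℝ ↦ 1 / 2 * (Real.log (2 - ε) + Real.log (2 + ε))) (𝓝 0)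
        (𝓝 (1 / 2 * (Real.log (2 - 0) + Real.log (2 + 0)))) :=
      ((((tendsto_const_nhds (x := (2 : ℝ))).sub tendsto_id).log (by norm_num)).add
        (((tendsto_const_nhds (x := (2 : ℝ))).add tendsto_id).log (by norm_num))).const_mul _
    have h2 : 1 / 2 * (Real.log (2 - 0) + Real.log (2 + 0)) = Real.log 2 := by
      simp only [sub_zero, add_zero]; ring
    rw [h2] at h
    exact ((Complex.continuous_ofReal.tendsto _).comp (h.mono_left nhdsWithin_le_nhds)).mul_const _

/-! ### Identification with Bombieri's integral -/

/-- `∫_ℝ g(t) dt/(4 cosh(t/2)) = ∫₀^∞ (g(t) + g(-t)) dt/(4 cosh(t/2))`. [folklore] -/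
private theorem integral_cosh_weight_eq (hg : IsWeilTest g) :
    ∫ t, ((1 / (4 * Real.cosh (t / 2)) : ℝ) : ℂ) * g t =
      ∫ t in Ioi 0, ((1 / (4 * Real.cosh (t / 2)) : ℝ) : ℂ) * (g t + g (-t)) := by
  have hint : Integrable fun t : ℝ ↦ ((1 / (4 * Real.cosh (t / 2)) : ℝ) : ℂ) * g t :=
    (continuous_cosh_weight.mul hg.1.continuous).integrable_of_hasCompactSupport hg.2.mul_left
  have hint' : Integrable fun t : ℝ ↦ ((1 / (4 * Real.cosh (t / 2)) : ℝ) : ℂ) * g (-t) :=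
    (continuous_cosh_weight.mul hg.comp_neg.1.continuous).integrable_of_hasCompactSupport
      hg.comp_neg.2.mul_left
  rw [← intervalIntegral.integral_Iic_add_Ioi hint.integrableOn hint.integrableOn]
  have hneg := integral_comp_neg_Ioi 0 (fun t : ℝ ↦ ((1 / (4 * Real.cosh (t / 2)) : ℝ) : ℂ) * g t)
  simp only [neg_zero, neg_div, Real.cosh_neg] at hneg
  rw [← hneg, ← integral_add hint'.integrableOn hint.integrableOn]
  refine setIntegral_congr_fun measurableSet_Ioi fun t _ ↦ ?_
  ring

/-- **Bombieri's integrand split** on `(0, ∞)`: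
`(e^{t/2}(g(t)+g(-t)) - 2g(0))/(2 sinh t) = (g(t)+g(-t))/(4 cosh(t/2))
 + (g(t)/(4 sinh(t/2)) - g(0)/(2 sinh t)) + (g(-t)/(4 sinh(t/2)) - g(0)/(2 sinh t))`
(`e^{t/2}/(2 sinh t) = 1/(4 sinh(t/2)) + 1/(4 cosh(t/2))`), integrated. [folklore] -/
private theorem integral_bombieri_split (hg : IsWeilTest g) :
    (∫ t in Ioi (0 : ℝ), ((Real.exp (t / 2) : ℂ) * (g t + g (-t)) - 2 * g 0) /
        (2 * Real.sinh t : ℂ)) =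
      (∫ t in Ioi 0, ((1 / (4 * Real.cosh (t / 2)) : ℝ) : ℂ) * (g t + g (-t)))
      + (∫ t in Ioi 0, (((1 / (4 * Real.sinh (t / 2)) : ℝ) : ℂ) * g t
          - ((1 / (2 * Real.sinh t) : ℝ) : ℂ) * g 0))
      + (∫ t in Ioi 0, (((1 / (4 * Real.sinh (t / 2)) : ℝ) : ℂ) * g (-t)
          - ((1 / (2 * Real.sinh t) : ℝ) : ℂ) * g 0)) := by
  have hg' : IsWeilTest (fun t ↦ g (-t)) := hg.comp_neg
  have hcoshI : IntegrableOn (fun t : ℝ ↦ ((1 / (4 * Real.cosh (t / 2)) : ℝ) : ℂ) * (g t + g (-t)))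
      (Ioi 0) :=
    ((continuous_cosh_weight.mul (hg.1.continuous.add hg'.1.continuous))
      |>.integrable_of_hasCompactSupport (hg.2.add hg'.2).mul_left).integrableOn
  have hB := integrableOn_archReg hg
  have hC := integrableOn_archReg hg'
  simp only [neg_zero] at hC
  have hAB : IntegrableOn (fun t : ℝ ↦ ((1 / (4 * Real.cosh (t / 2)) : ℝ) : ℂ) * (g t + g (-t))
      + (((1 / (4 * Real.sinh (t / 2)) : ℝ) : ℂ) * g t - ((1 / (2 * Real.sinh t) : ℝ) : ℂ) * g 0))
      (Ioi 0) := hcoshI.add hB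
  rw [← integral_add hcoshI hB, ← integral_add hAB hC]
  refine setIntegral_congr_fun measurableSet_Ioi fun t (ht : 0 < t) ↦ ?_
  have hs : Real.sinh (t / 2) ≠ 0 := (Real.sinh_pos_iff.2 (by positivity)).ne'
  have hc : Real.cosh (t / 2) ≠ 0 := (Real.cosh_pos _).ne'
  have hsinh : Real.sinh t = 2 * Real.sinh (t / 2) * Real.cosh (t / 2) :=
    sinh_eq_two_mul_sinh_half t
  have hexp : Real.exp (t / 2) = Real.cosh (t / 2) + Real.sinh (t / 2) :=
    (Real.cosh_add_sinh _).symm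
  rw [hsinh, hexp]
  set S : ℝ := Real.sinh (t / 2) with hSdef
  set C : ℝ := Real.cosh (t / 2) with hCdef
  have hs' : (S : ℂ) ≠ 0 := Complex.ofReal_ne_zero.2 hs
  have hc' : (C : ℂ) ≠ 0 := Complex.ofReal_ne_zero.2 hc
  push_cast
  field_simp
  ring

/-! ### The theorem -/

/-- The archimedean limit of App. II (36), identified: for a test function `g`,
`lim_{ε→0⁺} connesArchTrunc g ε = -weilArchTermBombieri g - (log 2π + γ) g(0)`, i.e.
Connes' `∫'_ℝ` (constant `λ = log 2π + γ`) is Bombieri's `-W_ℝ` (constant `log 4π + γ`): "the right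
hand side of (36) gives `λ - log 2`". [cite: Connes1999, App. II (36)–(37)] -/
theorem tendsto_connesArchTrunc (hg : IsWeilTest g) :
    Tendsto (connesArchTrunc g) (𝓝[>] 0)
      (𝓝 (-weilArchTermBombieri g -
        (Real.log (2 * Real.pi) + Real.eulerMascheroniConstant : ℂ) * g 0)) := by
  have h := tendsto_connesArchTrunc' hg
  rw [integral_cosh_weight_eq hg] at h
  convert h using 2
  rw [weilArchTermBombieri_eq, integral_bombieri_split hg]
  have h4 : Real.log (4 * Real.pi) = Real.log 2 + Real.log (2 * Real.pi) := by
    rw [show (4 : ℝ) * Real.pi = 2 * (2 * Real.pi) by ring,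
      Real.log_mul (by norm_num) (by positivity)]
  rw [h4]
  push_cast
  ring

/-- **Connes' archimedean principal value is minus the tree's archimedean term**, unconditionally:
`connesArchPV g = -weilArchTerm g` for every test function `g` (App. II (36)–(37) vs Bombieri 2000
Thm 2 / Iwaniec–Kowalski (5.44)). [cite: Connes1999, App. II (36)–(37)] -/
theorem connesArchPV_eq_neg_weilArchTerm (hg : IsWeilTest g) :
    connesArchPV g = -weilArchTerm g := by
  rw [connesArchPV, (tendsto_connesArchTrunc hg).limUnder_eq,
    ← weilArchTermBombieri_eq_weilArchTerm_holds hg]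
  ring

/-- **Connes 1999, Appendix II, Theorem 6, for `k = ℚ`** — DISCHARGED: the named fact
`Connes1999_thm_6_rat` holds. Proof = the source's architecture with the tree's inputs: Weil's
explicit formula (`explicit_formula_holds`, Bombieri's normalisation), the finite places
(`tsum_connesLocalTerm_eq_weilPrimeTerm`), and the archimedean comparison App. II (36)–(37)
(`connesArchPV_eq_neg_weilArchTerm`). [cite: Connes1999, App. II Thm 6] -/
theorem Connes1999_thm_6_rat_holds : Connes1999_thm_6_rat := by
  intro g hg
  refine ⟨⟨_, tendsto_connesArchTrunc hg⟩, ?_⟩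
  have hef : HasWeilZeroSide g (weilFunctional g) := explicit_formula_holds hg
  rw [tsum_connesLocalTerm_eq_weilPrimeTerm hg, connesArchPV_eq_neg_weilArchTerm hg]
  convert hef using 1
  unfold weilFunctional
  ring

end ArchDischarge

end Literature.NumberTheory.ConnesConsani

end
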